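import Literature.Analysis.FluidPDE.NormalisedPressureDifferenceLp
import Literature.Analysis.FluidPDE.WholeSpacePressureL3
import Literature.Analysis.FluidPDE.MollifiedLimits
import HarnessLib

/-!
# The normalised (Riesz-transform) pressure on the class `|w|² ∈ Lᵖ(ℝ³)`, `1 < p < ∞`

Analysis/FluidPDE proof file (theorems only; no definitions, no named facts). The tree's
**normalised pressure** `p̃[w] = -|w|²/3 + p.v.∫ K(x-y)(w(y)) dy` (`normalisedPressure`, Tao 2013,
(35); the Navier–Stokes pressure `Δp̃ = -∂ᵢ∂ⱼ(wᵢwⱼ)` of the velocity `w`, i.e.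
`p̃ = Σᵢⱼ ℛᵢℛⱼ(wᵢwⱼ)`) is defined pointwise, by a principal value, with junk `0` where the
principal value does not exist. On test fields the tree knows everything about it; on the natural
**Lebesgue class** — measurable `w` with `|w|² ∈ Lᵖ`, equivalently `w ∈ L²ᵖ`, `1 < p < ∞` — the
tree has the Calderón–Zygmund bound `‖p̃[w]‖_p ≤ C_p ‖|w|²‖_p` together with the a.e. existence
of the principal value (`stein1970_normalisedPressure_ae_Lp_bound_holds`, Stein 1970, Ch. II §4.2
Thm. 3 with §4.5 Thm. 4) and the bilinear truncated theory of `NormalisedPressureBilinear`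
(there specialised to the exponents `3/2`, `2` of the weak–strong uniqueness argument). This file
completes the `Lᵖ`-class theory at a **general exponent**, which is what the construction of the
pressure of a weak solution with velocity in `L²ᵖ_{t,x}` consumes (`p = 3/2`: Leray–Hopf and local
Leray solutions; `p = 5/3`: the `L^{10/3}` class of the energy space, e.g. Bradshaw–Tsai 2017,
proof of Thm. 2.4, "`‖p_ε‖_{L^{5/3}} ≤ C‖U_ε‖²_{L^{10/3}} + C‖W‖²_{L^{10/3}}` … apply the
Calderón–Zygmund theory"; `p = 5/4`: Caffarelli–Kohn–Nirenberg):

* `exists_normalisedPressure_sub_ae_eq` — **the difference of two normalised pressures on the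
  class**: for `|a|², |b|² ∈ Lᵖ`, `p̃[a] - p̃[b] = -⟨a-b, a+b⟩/3 + P` a.e. with `P` the
  bilinear principal value of `B(a-b, a+b)`, `‖P‖_p ≤ (27/2)A_p ‖|a-b||a+b|‖_p` (the a.e.
  identity behind the tree's bilinear Calderón–Zygmund estimate
  `exists_eLpNorm_normalisedPressure_sub_le` of `NormalisedPressureDifferenceLp`, which records only
  the norm bound; the identity is what gives measurability below);
* `aestronglyMeasurable_normalisedPressure_of_sq`, `memLp_normalisedPressure_of_sq` — `p̃[w]` is
  a.e.-strongly measurable and lies in `Lᵖ` (the case `b = 0`, and Stein's bound);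
* `tendsto_eLpNorm_normalisedPressure_sub_of_sq` — **continuity**: `‖|aₙ-a||aₙ+a|‖_p → 0`
  implies `p̃[aₙ] → p̃[a]` in `Lᵖ` (from `exists_eLpNorm_normalisedPressure_sub_le`); with the
  Hölder form `eLpNorm_norm_mul_norm_le_two_mul` (`‖|f||g|‖_p ≤ ‖f‖_{2p}‖g‖_{2p}`) this is
  continuity `L²ᵖ → Lᵖ` (`tendsto_eLpNorm_normalisedPressure_sub_of_tendsto_two_mul`);
* `integral_normalisedPressure_mul_laplacian_of_memLp` — **the weak pressure Poisson equation on
  the class**: for `w ∈ L²ᵖ` and every test function `θ`,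
  `∫ p̃[w] Δθ = -∫ D²θ(w, w)` (`= -Σᵢⱼ ∫ wᵢwⱼ ∂ᵢ∂ⱼθ`), by density of test fields in `L²ᵖ`
  (`exists_smooth_seq_tendsto_eLpNorm_withDensity`), the identity for test fields
  (`integral_normalisedPressure_mul_laplacian_eq_neg`) and the two continuity statements
  (Tsai 1998, proof of Lemma 2.1, p. 34: "We then extend this result to general `U ∈ L^q` by
  approximation"; Lemarié-Rieusset 2016, Prop. 6.2).

## Mathlib / tree search

Tree (all used): `normalisedPressure`, `HasPressurePV`, `normalisedPressure_eq`,
`normalisedPressure_zero` (`NormalisedPressure`); `ae_exists_hasPressurePV`,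
`integrableOn_pressureKernel_of_memLp`, `stein1970_normalisedPressure_ae_Lp_bound_holds`
(`LocalLerayPressureDecompositionProofs`); `exists_bilinear_pv`, `truncatedPressureIntegral_sub_eq`,
`normalisedPressure_sub_eq`, `norm_sq_sub_norm_sq_eq_inner`
(`NormalisedPressureBilinear`); `exists_eLpNorm_normalisedPressure_sub_le`,
`memLp_norm_sub_mul_norm_add` (`NormalisedPressureDifferenceLp`, the bilinear Calderón–Zygmund
estimate at a general exponent, landed for Leray's regularised scheme); `exists_eLpNorm_rieszTrunc_le`
(`RieszPressureTruncations`);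
`integral_normalisedPressure_mul_laplacian_eq_neg`, `exists_smooth_seq_tendsto_eLpNorm_withDensity`
(`TsaiWeightedRieszPressureProofs`); `tendsto_integral_mul_of_tendsto_eLpNorm_sub`
(`WholeSpacePressureL3`); `tendsto_eLpNorm_bilin_sub` (`MollifiedLimits`).
`lean search 'normalisedPressure.*laplacian|rieszPressure'`: the weak Poisson equation is in the
tree for test fields (`integral_normalisedPressure_mul_laplacian(_eq_neg)`) and, at the single
exponent `3`, for the `L³ → L^{3/2}` operator `rieszPressure` (`RieszPressureL3`,
`integral_rieszPressure_mul_laplacian`); `NecasRuzickaSverakRiesz.exists_rieszPressure` gives, for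
every exponent, *some* `Lᵖ` function with the Poisson equation, not identified with `p̃[w]`;
`OseenKernelLp.eLpNorm_norm_mul_norm_le` is the general Hölder-triple form of the product bound (the
`2p` specialisation is re-derived here in three lines rather than importing the Oseen kernel). The
measurability, continuity and Poisson statements of this file, for `p̃[w]` itself at a general
exponent, are new in the tree. Mathlib:
`eLpNorm_le_eLpNorm_mul_eLpNorm_of_nnnorm`, `eLpNorm_norm_rpow`, `ENNReal.HolderTriple`.

## References

* E. M. Stein, *Singular integrals and differentiability properties of functions* (1970),
  Ch. II §4.2 Thm. 3, §4.5 Thm. 4. [Stein1971]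
* T.-P. Tsai, Arch. Rational Mech. Anal. 143 (1998), Lemma 2.1 and its proof (p. 34). [Tsai1998]
* P. G. Lemarié-Rieusset, *The Navier–Stokes Problem in the 21st Century* (2016), Prop. 6.2.
  [LemarieRieusset2016]
* Z. Bradshaw, T.-P. Tsai, Ann. Henri Poincaré 18 (2017), proof of Thm. 2.4 (the `L^{5/3}` bound
  of the pressure by the Calderón–Zygmund theory). [BradshawTsai2017AHP]
-/

noncomputable section

open MeasureTheory TopologicalSpace Set Function Filter Topology Metric
open scoped ENNReal NNReal RealInnerProductSpace Laplacian ContDiff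

namespace Literature.Analysis.FluidPDE

-- nested operator types in the imported pressure files
set_option maxSynthPendingDepth 3


variable {p : ℝ≥0∞}

/-! ## Exponent bookkeeping: `|w|² ∈ Lᵖ ⟺ w ∈ L²ᵖ`, and Hölder `L²ᵖ × L²ᵖ → Lᵖ` -/

section Exponents

/-- `(2p, 2p, p)` is a Hölder triple: `(2p)⁻¹ + (2p)⁻¹ = p⁻¹`. [folklore] -/
theorem holderTriple_two_mul (p : ℝ≥0∞) : ENNReal.HolderTriple (2 * p) (2 * p) p := by
  refine ⟨?_⟩
  rw [ENNReal.mul_inv (Or.inl two_ne_zero) (Or.inl ENNReal.ofNat_ne_top), ← two_mul, ← mul_assoc,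
    ENNReal.mul_inv_cancel two_ne_zero ENNReal.ofNat_ne_top, one_mul]

/-- `‖|w|²‖_p = ‖w‖²_{2p}`. [folklore] -/
theorem eLpNorm_norm_sq_eq_two_mul {μ : Measure (EuclideanSpace ℝ (Fin 3))} (w : (EuclideanSpace ℝ (Fin 3)) → (EuclideanSpace ℝ (Fin 3))) (p : ℝ≥0∞) :
    eLpNorm (fun x => ‖w x‖ ^ 2) p μ = eLpNorm w (2 * p) μ ^ 2 := by
  have h := eLpNorm_norm_rpow w (p := p) (μ := μ) (q := 2) two_pos
  have e1 : (fun x => ‖w x‖ ^ (2 : ℝ)) = fun x => ‖w x‖ ^ 2 := by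
    funext x; exact Real.rpow_two _
  rw [e1, ENNReal.ofReal_ofNat, ENNReal.rpow_two, mul_comm] at h
  exact h

/-- `w ∈ L²ᵖ ⇒ |w|² ∈ Lᵖ`. [folklore] -/
theorem memLp_norm_sq_of_memLp_two_mul {w : (EuclideanSpace ℝ (Fin 3)) → (EuclideanSpace ℝ (Fin 3))} (hw : MemLp w (2 * p) volume) :
    MemLp (fun x => ‖w x‖ ^ 2) p volume := by
  refine ⟨(hw.1.norm.pow 2), ?_⟩
  rw [eLpNorm_norm_sq_eq_two_mul]
  exact ENNReal.pow_lt_top hw.eLpNorm_lt_top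

/-- **Hölder `L²ᵖ × L²ᵖ → Lᵖ` for the product of norms**: `‖|f||g|‖_p ≤ ‖f‖_{2p} ‖g‖_{2p}`. [folklore] -/
theorem eLpNorm_norm_mul_norm_le_two_mul {f g : (EuclideanSpace ℝ (Fin 3)) → (EuclideanSpace ℝ (Fin 3))} (hf : AEStronglyMeasurable f volume)
    (hg : AEStronglyMeasurable g volume) (p : ℝ≥0∞) :
    eLpNorm (fun y => ‖f y‖ * ‖g y‖) p volume ≤ eLpNorm f (2 * p) volume * eLpNorm g (2 * p) volume := by
  haveI := holderTriple_two_mul p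
  have h := eLpNorm_le_eLpNorm_mul_eLpNorm_of_nnnorm (p := 2 * p) (q := 2 * p) (r := p) hf hg
    (fun a b => ‖a‖ * ‖b‖) 1 (Eventually.of_forall fun x => by
      rw [one_mul]
      have : ‖‖f x‖ * ‖g x‖‖₊ = ‖f x‖₊ * ‖g x‖₊ := by
        rw [nnnorm_mul, nnnorm_norm, nnnorm_norm]
      rw [this])
  simpa using h

/-- `|f||g| ∈ Lᵖ` for `f, g ∈ L²ᵖ`. [folklore] -/
theorem memLp_norm_mul_norm {f g : (EuclideanSpace ℝ (Fin 3)) → (EuclideanSpace ℝ (Fin 3))} (hf : MemLp f (2 * p) volume)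
    (hg : MemLp g (2 * p) volume) : MemLp (fun y => ‖f y‖ * ‖g y‖) p volume := by
  refine ⟨hf.1.norm.mul hg.1.norm, ?_⟩
  refine (eLpNorm_norm_mul_norm_le_two_mul hf.1 hg.1 p).trans_lt ?_
  exact ENNReal.mul_lt_top hf.eLpNorm_lt_top hg.eLpNorm_lt_top

end Exponents

/-! ## The difference of two normalised pressures on the `Lᵖ` class -/

section Difference

/-- **The difference of two normalised pressures on the class `|·|² ∈ Lᵖ`.** Let `1 < p < ∞`.
There is `K < ∞` such that for all measurable `a, b : ℝ³ → ℝ³` with `|a|², |b|² ∈ Lᵖ` there is a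
measurable `P` with `p̃[a] - p̃[b] = -⟨a-b, a+b⟩/3 + P` a.e. and `‖P‖_p ≤ K ‖|a-b||a+b|‖_p`:
both principal values exist a.e. (`ae_exists_hasPressurePV`), the truncated integrals of
`K(a) - K(b)` are the truncated bilinear integrals of `B(a-b, a+b)`
(`truncatedPressureIntegral_sub_eq`), whose a.e. limit `P` obeys the bilinear Calderón–Zygmund
bound (`exists_bilinear_pv`, `K = (27/2)A_p`). [cite: Stein1971, Ch. II §4.2 Thm 3 and §4.5 Thm 4] -/
theorem exists_normalisedPressure_sub_ae_eq (hp1 : 1 < p) (hp2 : p < ⊤) :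
    ∃ K : ℝ≥0∞, K ≠ ⊤ ∧ ∀ a b : (EuclideanSpace ℝ (Fin 3)) → (EuclideanSpace ℝ (Fin 3)), AEStronglyMeasurable a volume →
      AEStronglyMeasurable b volume → MemLp (fun y => ‖a y‖ ^ 2) p volume →
      MemLp (fun y => ‖b y‖ ^ 2) p volume →
      ∃ P : (EuclideanSpace ℝ (Fin 3)) → ℝ, AEStronglyMeasurable P volume ∧
        ((fun x => normalisedPressure a x - normalisedPressure b x) =ᵐ[volume]
          fun x => -(3⁻¹ : ℝ) * ⟪a x - b x, a x + b x⟫ + P x) ∧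
        eLpNorm P p volume ≤ K * eLpNorm (fun y => ‖a y - b y‖ * ‖a y + b y‖) p volume := by
  obtain ⟨A, hAt, hA⟩ := exists_eLpNorm_rieszTrunc_le (p := p) hp1 hp2
  set K : ℝ≥0∞ := 27 * 2⁻¹ * A with hK
  have hKt : K ≠ ⊤ := by simp only [hK]; finiteness
  refine ⟨K, hKt, fun a b ha hb ha2 hb2 => ?_⟩
  -- conjugate exponent (integrability of the truncations)
  set q : ℝ≥0∞ := ENNReal.conjExponent p with hq
  haveI hpq : ENNReal.HolderConjugate p q := ENNReal.HolderConjugate.conjExponent hp1.le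
  have hq1 : 1 < q := (ENNReal.HolderConjugate.lt_top_iff_one_lt p q).1 hp2
  have hqt : q ≠ ⊤ := (ENNReal.HolderConjugate.ne_top_iff_ne_one q p).2 (ne_of_gt hp1)
  -- the two fields `c = a - b`, `s = a + b`
  set c : (EuclideanSpace ℝ (Fin 3)) → (EuclideanSpace ℝ (Fin 3)) := fun y => a y - b y with hc
  set s : (EuclideanSpace ℝ (Fin 3)) → (EuclideanSpace ℝ (Fin 3)) := fun y => a y + b y with hs
  have hcm : AEStronglyMeasurable c volume := ha.sub hb
  have hsm : AEStronglyMeasurable s volume := ha.add hb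
  have hcs : MemLp (fun y => ‖c y‖ * ‖s y‖) p volume := memLp_norm_sub_mul_norm_add ha hb ha2 hb2
  -- the bilinear principal value and the two quadratic ones
  obtain ⟨P, hPm, hP, hPb⟩ := exists_bilinear_pv (f := c) (g := s) hp1 hp2 hA hcm hsm hcs
  have hPVa := ae_exists_hasPressurePV hp1 hp2 ha ha2
  have hPVb := ae_exists_hasPressurePV hp1 hp2 hb hb2
  refine ⟨P, hPm, ?_, hPb⟩
  filter_upwards [hPVa, hPVb, hP] with x hxa hxb hxP
  obtain ⟨La, hLa⟩ := hxa
  obtain ⟨Lb, hLb⟩ := hxb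
  -- the truncations of the difference, for `ε > 0`
  have htrunc : ∀ ε : ℝ, 0 < ε → truncatedPressureIntegral a x ε - truncatedPressureIntegral b x ε =
      ∫ y in (closedBall x ε)ᶜ, pressureForm (x - y) (c y) (s y) := by
    intro ε hε
    have hIa := integrableOn_pressureKernel_of_memLp hq1 hqt ha ha2 x hε
    have hIb := integrableOn_pressureKernel_of_memLp hq1 hqt hb hb2 x hε
    rw [truncatedPressureIntegral_sub_eq hIa hIb]
    rfl
  -- pass to the limit `ε → 0⁺`
  have hlim : Tendsto (fun ε => truncatedPressureIntegral a x ε - truncatedPressureIntegral b x ε)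
      (𝓝[>] 0) (𝓝 (P x)) := by
    refine hxP.congr' ?_
    filter_upwards [self_mem_nhdsWithin] with ε hε
    exact (htrunc ε hε).symm
  have hlim' : Tendsto (fun ε => truncatedPressureIntegral a x ε - truncatedPressureIntegral b x ε)
      (𝓝[>] 0) (𝓝 (La - Lb)) := hLa.2.sub hLb.2
  have hLL : La - Lb = P x := tendsto_nhds_unique hlim' hlim
  rw [normalisedPressure_sub_eq hLa hLb, hLL, norm_sq_sub_norm_sq_eq_inner]
  ring

end Difference

/-! ## Measurability, the `Lᵖ` class and `Lᵖ`-continuity of `w ↦ p̃[w]` -/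

section Class

/-- **`p̃[w]` is a.e.-strongly measurable** for measurable `w` with `|w|² ∈ Lᵖ`, `1 < p < ∞`
(`p̃[w] = -|w|²/3 + P` a.e. with `P` the measurable a.e. limit of the truncated singular
integrals: the case `b = 0` of `exists_normalisedPressure_sub_ae_eq`). [cite: Stein1971, Ch. II §4.5 Thm 4 (a)] -/
theorem aestronglyMeasurable_normalisedPressure_of_sq (hp1 : 1 < p) (hp2 : p < ⊤) {w : (EuclideanSpace ℝ (Fin 3)) → (EuclideanSpace ℝ (Fin 3))}
    (hw : AEStronglyMeasurable w volume) (hw2 : MemLp (fun y => ‖w y‖ ^ 2) p volume) :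
    AEStronglyMeasurable (normalisedPressure w) volume := by
  obtain ⟨K, -, hK⟩ := exists_normalisedPressure_sub_ae_eq hp1 hp2
  have h0m : AEStronglyMeasurable (fun _ : (EuclideanSpace ℝ (Fin 3)) => (0 : (EuclideanSpace ℝ (Fin 3)))) volume := aestronglyMeasurable_const
  have h02 : MemLp (fun y : (EuclideanSpace ℝ (Fin 3)) => ‖(fun _ : (EuclideanSpace ℝ (Fin 3)) => (0 : (EuclideanSpace ℝ (Fin 3)))) y‖ ^ 2) p volume := by
    simp only [norm_zero, ne_eq, OfNat.ofNat_ne_zero, not_false_eq_true, zero_pow]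
    exact MemLp.zero' (ε := ℝ)
  obtain ⟨P, hPm, hident, -⟩ := hK w (fun _ => 0) hw h0m hw2 h02
  have hz : normalisedPressure (fun _ : (EuclideanSpace ℝ (Fin 3)) => (0 : (EuclideanSpace ℝ (Fin 3)))) = 0 := normalisedPressure_zero
  have hident' : normalisedPressure w =ᵐ[volume] fun x => -(3⁻¹ : ℝ) * ⟪w x, w x⟫ + P x := by
    filter_upwards [hident] with x hx
    simp only [hz, Pi.zero_apply, sub_zero, add_zero] at hx
    exact hx
  exact (((hw.inner hw).const_mul _).add hPm).congr hident'.symm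

/-- **`p̃[w] ∈ Lᵖ` with Stein's bound** for measurable `w` with `|w|² ∈ Lᵖ`, `1 < p < ∞`
(`stein1970_normalisedPressure_ae_Lp_bound_holds` and the measurability above). [cite: Stein1971, Ch. II §4.2 Thm 3 (b) and §4.5 Thm 4 (a)] -/
theorem memLp_normalisedPressure_of_sq (hp1 : 1 < p) (hp2 : p < ⊤) {w : (EuclideanSpace ℝ (Fin 3)) → (EuclideanSpace ℝ (Fin 3))}
    (hw : AEStronglyMeasurable w volume) (hw2 : MemLp (fun y => ‖w y‖ ^ 2) p volume) :
    MemLp (normalisedPressure w) p volume := by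
  obtain ⟨C, hC⟩ := stein1970_normalisedPressure_ae_Lp_bound_holds p hp1 hp2
  refine ⟨aestronglyMeasurable_normalisedPressure_of_sq hp1 hp2 hw hw2, ?_⟩
  refine lt_of_le_of_lt (hC w hw hw2).2 ?_
  exact ENNReal.mul_lt_top ENNReal.coe_lt_top hw2.eLpNorm_lt_top

/-- The same for `w ∈ L²ᵖ`. [cite: Stein1971, Ch. II §4.2 Thm 3 (b) and §4.5 Thm 4 (a)] -/
theorem memLp_normalisedPressure_of_memLp_two_mul (hp1 : 1 < p) (hp2 : p < ⊤) {w : (EuclideanSpace ℝ (Fin 3)) → (EuclideanSpace ℝ (Fin 3))}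
    (hw : MemLp w (2 * p) volume) : MemLp (normalisedPressure w) p volume :=
  memLp_normalisedPressure_of_sq hp1 hp2 hw.1 (memLp_norm_sq_of_memLp_two_mul hw)

/-- **Stein's bound in the `L²ᵖ` form**: `‖p̃[w]‖_p ≤ C_p ‖w‖²_{2p}` with the constant of the
named fact. [cite: Stein1971, Ch. II §4.2 Thm 3 (b)] -/
theorem exists_eLpNorm_normalisedPressure_le_sq (hp1 : 1 < p) (hp2 : p < ⊤) :
    ∃ C : ℝ≥0, ∀ w : (EuclideanSpace ℝ (Fin 3)) → (EuclideanSpace ℝ (Fin 3)), MemLp w (2 * p) volume →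
      eLpNorm (normalisedPressure w) p volume ≤ C * eLpNorm w (2 * p) volume ^ 2 := by
  obtain ⟨C, hC⟩ := stein1970_normalisedPressure_ae_Lp_bound_holds p hp1 hp2
  refine ⟨C, fun w hw => ?_⟩
  rw [← eLpNorm_norm_sq_eq_two_mul]
  exact (hC w hw.1 (memLp_norm_sq_of_memLp_two_mul hw)).2

/-- **`Lᵖ`-continuity of `w ↦ p̃[w]` on the class**: if `aₙ`, `a` are measurable with
`|aₙ|², |a|² ∈ Lᵖ` and `‖|aₙ - a| |aₙ + a|‖_p → 0`, then `p̃[aₙ] → p̃[a]` in `Lᵖ` (the bilinear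
estimate `exists_eLpNorm_normalisedPressure_sub_le`). [cite: Stein1971, Ch. II §4.2 Thm 3; Tsai1998, Lemma 2.1 proof (p. 34)] -/
theorem tendsto_eLpNorm_normalisedPressure_sub_of_sq (hp1 : 1 < p) (hp2 : p < ⊤)
    {a : ℕ → (EuclideanSpace ℝ (Fin 3)) → (EuclideanSpace ℝ (Fin 3))} {a₀ : (EuclideanSpace ℝ (Fin 3)) → (EuclideanSpace ℝ (Fin 3))} (ham : ∀ n, AEStronglyMeasurable (a n) volume)
    (ha₀m : AEStronglyMeasurable a₀ volume) (ha2 : ∀ n, MemLp (fun y => ‖a n y‖ ^ 2) p volume)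
    (ha₀2 : MemLp (fun y => ‖a₀ y‖ ^ 2) p volume)
    (h : Tendsto (fun n => eLpNorm (fun y => ‖a n y - a₀ y‖ * ‖a n y + a₀ y‖) p volume) atTop
      (𝓝 0)) :
    Tendsto (fun n => eLpNorm (fun x => normalisedPressure (a n) x - normalisedPressure a₀ x) p
      volume) atTop (𝓝 0) := by
  obtain ⟨C, hCt, hC⟩ := exists_eLpNorm_normalisedPressure_sub_le hp1 hp2
  have hlim : Tendsto (fun n => C * eLpNorm (fun y => ‖a n y - a₀ y‖ * ‖a n y + a₀ y‖) p volume)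
      atTop (𝓝 0) := by
    simpa using ENNReal.Tendsto.const_mul h (Or.inr hCt)
  exact tendsto_of_tendsto_of_tendsto_of_le_of_le tendsto_const_nhds hlim (fun n => zero_le)
    fun n => hC (a n) a₀ (ham n) ha₀m (ha2 n) ha₀2

/-- **Continuity `L²ᵖ → Lᵖ`**: if `aₙ → a` in `L²ᵖ` (all in `L²ᵖ`), then `p̃[aₙ] → p̃[a]` in
`Lᵖ` (`‖|aₙ-a||aₙ+a|‖_p ≤ ‖aₙ-a‖_{2p}(‖aₙ-a‖_{2p} + 2‖a‖_{2p})`). [cite: Tsai1998, Lemma 2.1 proof (p. 34)] -/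
theorem tendsto_eLpNorm_normalisedPressure_sub_of_tendsto_two_mul (hp1 : 1 < p) (hp2 : p < ⊤)
    {a : ℕ → (EuclideanSpace ℝ (Fin 3)) → (EuclideanSpace ℝ (Fin 3))} {a₀ : (EuclideanSpace ℝ (Fin 3)) → (EuclideanSpace ℝ (Fin 3))} (ha : ∀ n, MemLp (a n) (2 * p) volume)
    (ha₀ : MemLp a₀ (2 * p) volume)
    (h : Tendsto (fun n => eLpNorm (fun y => a n y - a₀ y) (2 * p) volume) atTop (𝓝 0)) :
    Tendsto (fun n => eLpNorm (fun x => normalisedPressure (a n) x - normalisedPressure a₀ x) p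
      volume) atTop (𝓝 0) := by
  have h12p : (1 : ℝ≥0∞) ≤ 2 * p :=
    calc (1 : ℝ≥0∞) = 1 * 1 := (one_mul 1).symm
      _ ≤ 2 * p := mul_le_mul' (by norm_num) hp1.le
  refine tendsto_eLpNorm_normalisedPressure_sub_of_sq hp1 hp2 (fun n => (ha n).1) ha₀.1
    (fun n => memLp_norm_sq_of_memLp_two_mul (ha n)) (memLp_norm_sq_of_memLp_two_mul ha₀) ?_
  -- `‖|aₙ - a||aₙ + a|‖_p ≤ ‖aₙ - a‖_{2p} ‖aₙ + a‖_{2p} ≤ ‖aₙ - a‖_{2p} (‖aₙ - a‖_{2p} + 2‖a‖_{2p})`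
  have hbound : ∀ n, eLpNorm (fun y => ‖a n y - a₀ y‖ * ‖a n y + a₀ y‖) p volume ≤
      eLpNorm (fun y => a n y - a₀ y) (2 * p) volume *
        (eLpNorm (fun y => a n y - a₀ y) (2 * p) volume + 2 * eLpNorm a₀ (2 * p) volume) := by
    intro n
    have hdm : AEStronglyMeasurable (fun y => a n y - a₀ y) volume := (ha n).1.sub ha₀.1
    have hsm : AEStronglyMeasurable (fun y => a n y + a₀ y) volume := (ha n).1.add ha₀.1
    have h2m : AEStronglyMeasurable (fun y => (2 : ℝ) • a₀ y) volume := ha₀.1.const_smul (2 : ℝ)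
    -- `aₙ + a = (aₙ - a) + 2a`
    have e : (fun y => a n y + a₀ y) = (fun y => a n y - a₀ y) + fun y => (2 : ℝ) • a₀ y := by
      funext y; simp only [Pi.add_apply, two_smul]; abel
    have e2 : eLpNorm (fun y => (2 : ℝ) • a₀ y) (2 * p) volume = 2 * eLpNorm a₀ (2 * p) volume := by
      rw [show (fun y => (2 : ℝ) • a₀ y) = (2 : ℝ) • a₀ from rfl, eLpNorm_const_smul,
        Real.enorm_eq_ofReal zero_le_two, ENNReal.ofReal_ofNat]
    have hsum_le : eLpNorm (fun y => a n y + a₀ y) (2 * p) volume ≤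
        eLpNorm (fun y => a n y - a₀ y) (2 * p) volume + 2 * eLpNorm a₀ (2 * p) volume := by
      rw [e, ← e2]
      exact eLpNorm_add_le hdm h2m h12p
    exact (eLpNorm_norm_mul_norm_le_two_mul hdm hsm p).trans (mul_le_mul' le_rfl hsum_le)
  have hlim : Tendsto (fun n => eLpNorm (fun y => a n y - a₀ y) (2 * p) volume *
      (eLpNorm (fun y => a n y - a₀ y) (2 * p) volume + 2 * eLpNorm a₀ (2 * p) volume)) atTop
      (𝓝 0) := by
    have h2 : Tendsto (fun n => eLpNorm (fun y => a n y - a₀ y) (2 * p) volume +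
        2 * eLpNorm a₀ (2 * p) volume) atTop (𝓝 (0 + 2 * eLpNorm a₀ (2 * p) volume)) :=
      h.add tendsto_const_nhds
    have hb : (0 : ℝ≥0∞) + 2 * eLpNorm a₀ (2 * p) volume ≠ ⊤ := by
      rw [zero_add]; exact ENNReal.mul_ne_top ENNReal.ofNat_ne_top ha₀.eLpNorm_lt_top.ne
    have h3 := ENNReal.Tendsto.mul h (Or.inr hb) h2 (Or.inr ENNReal.zero_ne_top)
    rw [zero_mul] at h3
    exact h3
  exact tendsto_of_tendsto_of_tendsto_of_le_of_le tendsto_const_nhds hlim (fun n => zero_le) hbound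

end Class

/-! ## The weak pressure Poisson equation on the `Lᵖ` class -/

section Poisson

/-- **Hessian pairings pass to `L²ᵖ` limits**: if `wₙ → U` in `L²ᵖ(ℝ³; ℝ³)`, `1 < p < ∞`, then
`∫ D²φ(wₙ, wₙ) → ∫ D²φ(U, U)` for every test function `φ` (expand along an orthonormal basis:
`D²φ(w,w) = Σᵢⱼ wᵢwⱼ ∂ᵢ∂ⱼφ`, the products `wₙ,ᵢwₙ,ⱼ → UᵢUⱼ` in `Lᵖ`, and `∂ᵢ∂ⱼφ ∈ L^{p'}`). [folklore] -/
theorem tendsto_integral_hessian_apply_of_tendsto_eLpNorm_two_mul (hp1 : 1 < p)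
    {w : ℕ → (EuclideanSpace ℝ (Fin 3)) → (EuclideanSpace ℝ (Fin 3))} {U : (EuclideanSpace ℝ (Fin 3)) → (EuclideanSpace ℝ (Fin 3))} (hw : ∀ n, MemLp (w n) (2 * p) volume)
    (hU : MemLp U (2 * p) volume)
    (hT : Tendsto (fun n => eLpNorm (w n - U) (2 * p) volume) atTop (𝓝 0))
    {φ : (EuclideanSpace ℝ (Fin 3)) → ℝ} (hφ : ContDiff ℝ (⊤ : ℕ∞) φ) (hφc : HasCompactSupport φ) :
    Tendsto (fun n => ∫ x, fderiv ℝ (fderiv ℝ φ) x (w n x) (w n x)) atTop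
      (𝓝 (∫ x, fderiv ℝ (fderiv ℝ φ) x (U x) (U x))) := by
  set b := stdOrthonormalBasis ℝ (EuclideanSpace ℝ (Fin 3)) with hb
  set q : ℝ≥0∞ := ENNReal.conjExponent p with hq
  haveI hpq : ENNReal.HolderConjugate p q := ENNReal.HolderConjugate.conjExponent hp1.le
  haveI := holderTriple_two_mul p
  have h12p : (1 : ℝ≥0∞) ≤ 2 * p :=
    calc (1 : ℝ≥0∞) = 1 * 1 := (one_mul 1).symm
      _ ≤ 2 * p := mul_le_mul' (by norm_num) hp1.le
  set L : (EuclideanSpace ℝ (Fin 3)) → (EuclideanSpace ℝ (Fin 3)) →L[ℝ] (EuclideanSpace ℝ (Fin 3)) →L[ℝ] ℝ := fderiv ℝ (fderiv ℝ φ) with hL_def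
  have hφ2 : ContDiff ℝ 2 φ := contDiff_infty.1 hφ 2
  have hLc : Continuous L :=
    (hφ2.fderiv_right (m := 1) (by norm_num)).continuous_fderiv one_ne_zero
  have hLcs : HasCompactSupport L := (hφc.fderiv (𝕜 := ℝ)).fderiv (𝕜 := ℝ)
  -- the scalar weights `∂ᵢ∂ⱼφ` and their class `L^{q}`
  set wt : Fin (Module.finrank ℝ (EuclideanSpace ℝ (Fin 3))) → Fin (Module.finrank ℝ (EuclideanSpace ℝ (Fin 3))) → (EuclideanSpace ℝ (Fin 3)) → ℝ :=
    fun i j x => L x (b i) (b j) with hwt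
  have hwtc : ∀ i j, Continuous (wt i j) := fun i j =>
    ((ContinuousLinearMap.apply ℝ ℝ (b j)).continuous.comp
      ((ContinuousLinearMap.apply ℝ ((EuclideanSpace ℝ (Fin 3)) →L[ℝ] ℝ) (b i)).continuous.comp hLc))
  have hwtcs : ∀ i j, HasCompactSupport (wt i j) := fun i j =>
    hLcs.mono' fun x hx => by
      by_contra h'
      refine (mem_support.1 hx) ?_
      change L x (b i) (b j) = 0
      rw [image_eq_zero_of_notMem_tsupport h']
      rfl
  have hwtq : ∀ i j, MemLp (wt i j) q volume := fun i j =>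
    (hwtc i j).memLp_of_hasCompactSupport (hwtcs i j)
  -- the coordinate products
  set βij : Fin (Module.finrank ℝ (EuclideanSpace ℝ (Fin 3))) → Fin (Module.finrank ℝ (EuclideanSpace ℝ (Fin 3))) → (EuclideanSpace ℝ (Fin 3)) →L[ℝ] (EuclideanSpace ℝ (Fin 3)) →L[ℝ] ℝ :=
    fun i j => (ContinuousLinearMap.mul ℝ ℝ).bilinearComp (innerSL ℝ (b i)) (innerSL ℝ (b j))
    with hβij
  have βij_apply : ∀ i j (u v : (EuclideanSpace ℝ (Fin 3))), βij i j u v = ⟪b i, u⟫ * ⟪b j, v⟫ := fun i j u v => by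
    simp [hβij]
  have hprod : ∀ i j, Tendsto (fun n => eLpNorm ((fun x => βij i j (w n x) (w n x)) -
      fun x => βij i j (U x) (U x)) p volume) atTop (𝓝 0) := fun i j =>
    tendsto_eLpNorm_bilin_sub (p := 2 * p) (q := 2 * p) (r := p) h12p hp1.le (βij i j)
      (fun n => (hw n).1) hU.1 (fun n => (hw n).1) hU.1 hU.eLpNorm_lt_top hU.eLpNorm_lt_top hT hT
  have hprodm : ∀ i j n, MemLp (fun x => βij i j (w n x) (w n x)) p volume := fun i j n =>
    memLp_bilin (p := 2 * p) (q := 2 * p) (r := p) (βij i j) (hw n) (hw n)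
  have hprod0 : ∀ i j, MemLp (fun x => βij i j (U x) (U x)) p volume := fun i j =>
    memLp_bilin (p := 2 * p) (q := 2 * p) (r := p) (βij i j) hU hU
  -- each scalar pairing converges
  have hij : ∀ i j, Tendsto (fun n => ∫ x, βij i j (w n x) (w n x) * wt i j x) atTop
      (𝓝 (∫ x, βij i j (U x) (U x) * wt i j x)) := fun i j =>
    tendsto_integral_mul_of_tendsto_eLpNorm_sub (p := p) (q := q) (hprodm i j) (hprod0 i j)
      (hprod i j) (hwtq i j)
  -- the expansion of the Hessian pairing along the basis
  have hexp : ∀ (v : (EuclideanSpace ℝ (Fin 3))) (x : (EuclideanSpace ℝ (Fin 3))), L x v v = ∑ i, ∑ j, βij i j v v * wt i j x := by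
    intro v x
    -- expand the second slot, then the first
    have key : ∀ u : (EuclideanSpace ℝ (Fin 3)), L x u v = ∑ j, ⟪b j, v⟫ * L x u (b j) := fun u => by
      conv_lhs => rw [← b.sum_repr' v]
      rw [map_sum]
      exact Finset.sum_congr rfl fun j _ => by rw [map_smul, smul_eq_mul]
    have key2 : ∀ u' : (EuclideanSpace ℝ (Fin 3)), L x v u' = ∑ i, ⟪b i, v⟫ * L x (b i) u' := fun u' => by
      conv_lhs => rw [← b.sum_repr' v]
      rw [map_sum, FunLike.coe_sum, Finset.sum_apply]
      exact Finset.sum_congr rfl fun i _ => by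
        rw [map_smul, FunLike.coe_smul, Pi.smul_apply, smul_eq_mul]
    rw [key v, Finset.sum_comm]
    refine Finset.sum_congr rfl fun j _ => ?_
    rw [key2 (b j), Finset.mul_sum]
    refine Finset.sum_congr rfl fun i _ => ?_
    rw [βij_apply]
    simp only [hwt]
    ring
  have hint : ∀ {v : (EuclideanSpace ℝ (Fin 3)) → (EuclideanSpace ℝ (Fin 3))}, MemLp v (2 * p) volume → ∀ i j,
      Integrable (fun x => βij i j (v x) (v x) * wt i j x) volume := fun {v} hv i j => by
    have h1 : MemLp (fun x => βij i j (v x) (v x)) p volume :=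
      memLp_bilin (p := 2 * p) (q := 2 * p) (r := p) (βij i j) hv hv
    have h2 : MemLp ((fun x => βij i j (v x) (v x)) * wt i j) 1 volume := (hwtq i j).mul h1
    exact memLp_one_iff_integrable.1 h2
  have hsum : ∀ {v : (EuclideanSpace ℝ (Fin 3)) → (EuclideanSpace ℝ (Fin 3))}, MemLp v (2 * p) volume →
      ∫ x, L x (v x) (v x) = ∑ i, ∑ j, ∫ x, βij i j (v x) (v x) * wt i j x := by
    intro v hv
    rw [integral_congr_ae (Eventually.of_forall fun x => hexp (v x) x),
      integral_finsetSum _ fun i _ => integrable_finsetSum _ fun j _ => hint hv i j]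
    exact Finset.sum_congr rfl fun i _ => integral_finsetSum _ fun j _ => hint hv i j
  rw [hsum hU]
  have e : (fun n => ∫ x, L x (w n x) (w n x)) =
      fun n => ∑ i, ∑ j, ∫ x, βij i j (w n x) (w n x) * wt i j x := by
    funext n; exact hsum (hw n)
  rw [e]
  exact tendsto_finsetSum _ fun i _ => tendsto_finsetSum _ fun j _ => hij i j

/-- **The weak pressure Poisson equation on the class `w ∈ L²ᵖ`**, `1 < p < ∞`: for every test
function `θ`, `∫ p̃[w] Δθ = -∫ D²θ(w, w)`, i.e. `Δp̃[w] = -∂ᵢ∂ⱼ(wᵢwⱼ)` in `𝒟'(ℝ³)`. Proof by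
approximation (Tsai 1998, proof of Lemma 2.1: "We then extend this result to general `U ∈ L^q` by
approximation"): test fields `wₙ → w` in `L²ᵖ` (`exists_smooth_seq_tendsto_eLpNorm_withDensity`),
the identity for `wₙ` (`integral_normalisedPressure_mul_laplacian_eq_neg`), `p̃[wₙ] → p̃[w]` in
`Lᵖ` against `Δθ ∈ L^{p'}` and `∫ D²θ(wₙ,wₙ) → ∫ D²θ(w,w)`. [cite: Tsai1998, Lemma 2.1 proof (p. 34) and (2.5); LemarieRieusset2016, Prop. 6.2] -/
theorem integral_normalisedPressure_mul_laplacian_of_memLp (hp1 : 1 < p) (hp2 : p < ⊤)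
    {w : (EuclideanSpace ℝ (Fin 3)) → (EuclideanSpace ℝ (Fin 3))} (hw : MemLp w (2 * p) volume) {θ : (EuclideanSpace ℝ (Fin 3)) → ℝ} (hθ : ContDiff ℝ ∞ θ)
    (hθc : HasCompactSupport θ) :
    ∫ x, normalisedPressure w x * (Δ θ) x = -∫ x, fderiv ℝ (fderiv ℝ θ) x (w x) (w x) := by
  set q : ℝ≥0∞ := ENNReal.conjExponent p with hq
  haveI hpq : ENNReal.HolderConjugate p q := ENNReal.HolderConjugate.conjExponent hp1.le
  have h12p : (1 : ℝ≥0∞) ≤ 2 * p :=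
    calc (1 : ℝ≥0∞) = 1 * 1 := (one_mul 1).symm
      _ ≤ 2 * p := mul_le_mul' (by norm_num) hp1.le
  have h2pt : 2 * p ≠ ⊤ := ENNReal.mul_ne_top ENNReal.ofNat_ne_top hp2.ne
  -- test fields `wₙ → w` in `L²ᵖ`
  have h0 : (volume.withDensity fun x : (EuclideanSpace ℝ (Fin 3)) => ‖x‖ₑ ^ (0 : ℝ)) = volume := by
    simp only [ENNReal.rpow_zero]
    exact withDensity_one
  obtain ⟨v, hv, hvT⟩ := exists_smooth_seq_tendsto_eLpNorm_withDensity (G := (EuclideanSpace ℝ (Fin 3))) (p := 2 * p)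
    (by norm_num : (-3 : ℝ) < 0) h12p h2pt (U := w) (by rw [h0]; exact hw)
  rw [h0] at hvT
  have hvm : ∀ n, MemLp (v n) (2 * p) volume := fun n =>
    (hv n).1.continuous.memLp_of_hasCompactSupport (hv n).2
  -- the identity for the test fields
  have hidn : ∀ n, ∫ x, normalisedPressure (v n) x * (Δ θ) x =
      -∫ x, fderiv ℝ (fderiv ℝ θ) x (v n x) (v n x) := fun n =>
    integral_normalisedPressure_mul_laplacian_eq_neg (hv n).1 (hv n).2 hθ hθc
  -- left-hand sides converge
  have hΔc : HasCompactSupport (Δ θ) :=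
    hθc.mono' fun x hx => by
      contrapose! hx
      exact notMem_support.2 (laplacian_eq_zero_of_notMem_tsupport hx)
  have hΔθ : MemLp (Δ θ) q volume :=
    (continuous_laplacian (contDiff_infty.1 hθ 2)).memLp_of_hasCompactSupport hΔc
  have hconvP : Tendsto (fun n => eLpNorm (normalisedPressure (v n) - normalisedPressure w) p volume)
      atTop (𝓝 0) := by
    have h := tendsto_eLpNorm_normalisedPressure_sub_of_tendsto_two_mul hp1 hp2 hvm hw
      (by simpa [Pi.sub_def] using hvT)
    exact h
  have hL : Tendsto (fun n => ∫ x, normalisedPressure (v n) x * (Δ θ) x) atTop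
      (𝓝 (∫ x, normalisedPressure w x * (Δ θ) x)) :=
    tendsto_integral_mul_of_tendsto_eLpNorm_sub (p := p) (q := q)
      (fun n => memLp_normalisedPressure_of_memLp_two_mul hp1 hp2 (hvm n))
      (memLp_normalisedPressure_of_memLp_two_mul hp1 hp2 hw) hconvP hΔθ
  -- right-hand sides converge
  have hR : Tendsto (fun n => -∫ x, fderiv ℝ (fderiv ℝ θ) x (v n x) (v n x)) atTop
      (𝓝 (-∫ x, fderiv ℝ (fderiv ℝ θ) x (w x) (w x))) :=
    (tendsto_integral_hessian_apply_of_tendsto_eLpNorm_two_mul hp1 hvm hw hvT hθ hθc).neg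
  exact tendsto_nhds_unique (hL.congr hidn) hR

/-- The weak pressure Poisson equation in the `|w|² ∈ Lᵖ` form of the hypotheses. [cite: Tsai1998, Lemma 2.1 proof (p. 34) and (2.5)] -/
theorem integral_normalisedPressure_mul_laplacian_of_sq (hp1 : 1 < p) (hp2 : p < ⊤)
    {w : (EuclideanSpace ℝ (Fin 3)) → (EuclideanSpace ℝ (Fin 3))} (hw : AEStronglyMeasurable w volume) (hw2 : MemLp (fun y => ‖w y‖ ^ 2) p volume)
    {θ : (EuclideanSpace ℝ (Fin 3)) → ℝ} (hθ : ContDiff ℝ ∞ θ) (hθc : HasCompactSupport θ) :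
    ∫ x, normalisedPressure w x * (Δ θ) x = -∫ x, fderiv ℝ (fderiv ℝ θ) x (w x) (w x) := by
  refine integral_normalisedPressure_mul_laplacian_of_memLp hp1 hp2 ⟨hw, ?_⟩ hθ hθc
  have h := hw2.eLpNorm_lt_top
  rw [eLpNorm_norm_sq_eq_two_mul] at h
  by_contra htop
  rw [not_lt, top_le_iff] at htop
  rw [htop, ENNReal.top_pow two_ne_zero] at h
  exact lt_irrefl _ h

end Poisson

end Literature.Analysis.FluidPDE
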